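import Mathlib.Combinatorics.SimpleGraph.Clique
import Mathlib.Data.Finset.Powerset
import Mathlib.Data.Sym.Sym2
import Literature.Computability.Complexity.CircuitLowerBounds
import HarnessLib

/-!
# Test graphs for CLIQUE lower bounds: cliques and cocliques (Jukna 2012, §9.1)

The approximation method (Razborov 1985; Alon–Boppana 1987; Amano–Maruoka 1996/2005) analyses
a circuit for `CLIQUE(m, s)` on two families of inputs (Jukna 2012, §9.1, p. 245):

* **positive graphs**: `s`-cliques — a clique on some `s` vertices and no other edges;
* **negative graphs**: `(s-1)`-cocliques — colour the vertices with `s - 1` colours and join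
  vertices of different colours (complete `(s-1)`-partite graphs; colourings are counted with
  multiplicity).

This file provides them as edge-indicator vectors `(⊤ : SimpleGraph (Fin m)).edgeSet → Bool`,
the input type of `Literature.Computability.Complexity.cliqueFn` (`CircuitLowerBounds.lean`), and PROVES the basic facts:

* `cliqueGraph x` — the graph spanned by `x` (`cliqueFn m s x = decide (¬ CliqueFree s)`,
  `cliqueFn_eq`), `cliqueGraph_adj`, `cliqueGraph_mono`;
* `cliqueFn_monotone_holds : cliqueFn_monotone` — discharge of the named fact of
  `CircuitLowerBounds.lean` (adding edges preserves cliques);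
* `cliqueVec S` (all edges inside `S`), `cliqueFn_cliqueVec : s ≤ #S → CLIQUE = 1`;
* `colorVec h` for a colouring `h : Fin m → Fin c` (edges between colour classes),
  `cliqueFn_colorVec : c < s → CLIQUE = 0` (a clique is rainbow, pigeonhole);
* the finite families `posGraphs m s` (images of the `s`-subsets) and `negGraphs m s` (images
  of all `(s-1)`-colourings) with `cliqueFn_of_mem_posGraphs`, `cliqueFn_of_mem_negGraphs`,
  and their nonemptiness for `1 ≤ s ≤ m` resp. `2 ≤ s`.

These are the leaves "3a" of the decomposition of `Literature.Computability.Complexity.amano_maruoka` (see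
`AmanoMaruoka.lean`) and serve `razborov_alon_boppana` (pnp.S22) equally.
`Literature.Probability.RandomGraphs.PlantedClique.graphOfEdgeVec` (topic Probability/RandomGraphs) is the same graph as
`cliqueGraph` (definitionally); it is not imported here to keep the complexity topic free of the
probability/cryptography imports of that file.

## References

* S. Jukna, *Boolean Function Complexity* (2012), §9.1, p. 245 (positive and negative graphs)
  [Jukna2012].
* A. A. Razborov, *Lower bounds on the monotone complexity of some Boolean functions*, Dokl.
  Akad. Nauk SSSR 281 (1985) [Razborov1985]; N. Alon, R. Boppana, Combinatorica 7 (1987), §3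
  [AlonBoppana1987].
-/

namespace Literature.Computability.Complexity

open Finset

variable {m : ℕ}

/-! ### The graph of an edge vector -/

/-- The simple graph on `Fin m` spanned by the edge-indicator vector `x` (the graph fed to
`CLIQUE`; Jukna 2012, §9.1). Definitionally the graph inside `cliqueFn` and
`Literature.Probability.RandomGraphs.PlantedClique.graphOfEdgeVec`. [cite: Jukna2012, §9.1] -/
def cliqueGraph (x : (⊤ : SimpleGraph (Fin m)).edgeSet → Bool) : SimpleGraph (Fin m) :=
  SimpleGraph.fromEdgeSet
    {e : Sym2 (Fin m) | ∃ h : e ∈ (⊤ : SimpleGraph (Fin m)).edgeSet, x ⟨e, h⟩ = true}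

open Classical in
/-- `CLIQUE(m, s)(x)` decides whether `cliqueGraph x` has an `s`-clique (definitional).
[folklore] -/
theorem cliqueFn_eq (s : ℕ) (x : (⊤ : SimpleGraph (Fin m)).edgeSet → Bool) :
    cliqueFn m s x = decide (¬ (cliqueGraph x).CliqueFree s) := rfl

/-- `CLIQUE = 1` iff the graph is not `s`-clique-free. [folklore] -/
theorem cliqueFn_eq_true_iff (s : ℕ) (x : (⊤ : SimpleGraph (Fin m)).edgeSet → Bool) :
    cliqueFn m s x = true ↔ ¬ (cliqueGraph x).CliqueFree s := by
  classical
  rw [cliqueFn_eq, decide_eq_true_eq]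

/-- `CLIQUE = 0` iff the graph is `s`-clique-free. [folklore] -/
theorem cliqueFn_eq_false_iff (s : ℕ) (x : (⊤ : SimpleGraph (Fin m)).edgeSet → Bool) :
    cliqueFn m s x = false ↔ (cliqueGraph x).CliqueFree s := by
  classical
  rw [cliqueFn_eq, decide_eq_false_iff_not, not_not]

/-- Adjacency in `cliqueGraph x`: distinct vertices whose edge indicator is on. [folklore] -/
theorem cliqueGraph_adj (x : (⊤ : SimpleGraph (Fin m)).edgeSet → Bool) (u v : Fin m) :
    (cliqueGraph x).Adj u v ↔ ∃ h : u ≠ v, x ⟨s(u, v), by simpa using h⟩ = true := by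
  simp only [cliqueGraph, SimpleGraph.fromEdgeSet_adj, Set.mem_setOf_eq, ne_eq]
  constructor
  · rintro ⟨⟨h, hx⟩, hne⟩
    exact ⟨hne, hx⟩
  · rintro ⟨hne, hx⟩
    exact ⟨⟨by simpa using hne, hx⟩, hne⟩

/-- More edges, bigger graph. [folklore] -/
theorem cliqueGraph_mono {x y : (⊤ : SimpleGraph (Fin m)).edgeSet → Bool} (hxy : x ≤ y) :
    cliqueGraph x ≤ cliqueGraph y := by
  intro u v huv
  rw [cliqueGraph_adj] at huv ⊢
  obtain ⟨hne, hx⟩ := huv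
  refine ⟨hne, ?_⟩
  have := hxy ⟨s(u, v), by simpa using hne⟩
  rw [hx] at this
  exact top_le_iff.1 this

/-- **Discharge of `cliqueFn_monotone`** (`CircuitLowerBounds.lean`): the clique function is
monotone — adding edges preserves cliques (Jukna 2012, §9.1: "setting more edges to 1 can only
increase the size of the largest clique"). [cite: Jukna2012, §9.1] -/
theorem cliqueFn_monotone_holds : cliqueFn_monotone := by
  intro m s x y hxy
  cases hx : cliqueFn m s x
  · exact Bool.false_le _
  · rw [cliqueFn_eq_true_iff] at hx
    have hy : cliqueFn m s y = true :=
      (cliqueFn_eq_true_iff s y).2 fun hfree => hx (hfree.anti (cliqueGraph_mono hxy))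
    rw [hy]

/-! ### Positive graphs: cliques -/

open Classical in
/-- The **clique vector** of a vertex set `S`: exactly the edges with both endpoints in `S` are
on (a clique on `S` and isolated vertices elsewhere; Jukna 2012, §9.1, positive graphs).
[cite: Jukna2012, §9.1] -/
noncomputable def cliqueVec (S : Finset (Fin m)) : (⊤ : SimpleGraph (Fin m)).edgeSet → Bool :=
  fun e => decide (∀ v ∈ (e : Sym2 (Fin m)), v ∈ S)

/-- Adjacency in the clique vector's graph: distinct vertices of `S`. [folklore] -/
theorem cliqueGraph_cliqueVec_adj (S : Finset (Fin m)) (u v : Fin m) :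
    (cliqueGraph (cliqueVec S)).Adj u v ↔ u ≠ v ∧ u ∈ S ∧ v ∈ S := by
  rw [cliqueGraph_adj]
  simp only [cliqueVec, Sym2.mem_iff, forall_eq_or_imp, forall_eq, decide_eq_true_eq]
  constructor
  · rintro ⟨hne, hu, hv⟩
    exact ⟨hne, hu, hv⟩
  · rintro ⟨hne, hu, hv⟩
    exact ⟨hne, hu, hv⟩

/-- `S` is a clique of its clique vector. [folklore] -/
theorem isClique_cliqueVec (S : Finset (Fin m)) :
    (cliqueGraph (cliqueVec S)).IsClique (S : Set (Fin m)) := by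
  intro u hu v hv huv
  exact (cliqueGraph_cliqueVec_adj S u v).2 ⟨huv, hu, hv⟩

/-- **Positive graphs are accepted**: if `s ≤ #S` then `CLIQUE(m, s)` accepts the clique
vector of `S` (Jukna 2012, §9.1). [cite: Jukna2012, §9.1] -/
theorem cliqueFn_cliqueVec {s : ℕ} {S : Finset (Fin m)} (hs : s ≤ #S) :
    cliqueFn m s (cliqueVec S) = true := by
  rw [cliqueFn_eq_true_iff]
  obtain ⟨T, hTS, hT⟩ := Finset.exists_subset_card_eq hs
  intro hfree
  refine hfree T ⟨?_, hT⟩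
  exact (isClique_cliqueVec S).subset (by exact_mod_cast hTS)

/-! ### Negative graphs: cocliques from colourings -/

/-- The **coclique (colouring) vector** of a colouring `h : Fin m → Fin c`: the edge `{u, v}` is
on iff `h u ≠ h v` — the complete `c`-partite graph of the colour classes (Jukna 2012, §9.1,
negative graphs, with `c = s - 1`). [cite: Jukna2012, §9.1] -/
def colorVec {c : ℕ} (h : Fin m → Fin c) : (⊤ : SimpleGraph (Fin m)).edgeSet → Bool :=
  fun e => !decide ((e : Sym2 (Fin m)).map h).IsDiag

/-- Adjacency in the colouring vector's graph: differently coloured vertices. [folklore] -/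
theorem cliqueGraph_colorVec_adj {c : ℕ} (h : Fin m → Fin c) (u v : Fin m) :
    (cliqueGraph (colorVec h)).Adj u v ↔ h u ≠ h v := by
  rw [cliqueGraph_adj]
  simp only [colorVec, Sym2.map_mk, Sym2.mk_isDiag_iff, Bool.not_eq_true',
    decide_eq_false_iff_not, ne_eq]
  constructor
  · rintro ⟨-, h⟩
    exact h
  · intro hh
    exact ⟨fun huv => hh (by rw [huv]), hh⟩

/-- **Negative graphs are rejected**: a clique of the colouring graph is rainbow, so with
`c < s` colours `CLIQUE(m, s)` rejects the colouring vector (Jukna 2012, §9.1).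
[cite: Jukna2012, §9.1] -/
theorem cliqueFn_colorVec {c s : ℕ} (h : Fin m → Fin c) (hc : c < s) :
    cliqueFn m s (colorVec h) = false := by
  rw [cliqueFn_eq_false_iff]
  rintro T ⟨hclique, hcard⟩
  have hinj : Set.InjOn h (T : Set (Fin m)) := by
    intro u hu v hv huv
    by_contra hne
    exact ((cliqueGraph_colorVec_adj h u v).1 (hclique hu hv hne)) huv
  have h1 : #(T.image h) = #T := Finset.card_image_of_injOn hinj
  have h2 : #(T.image h) ≤ c := by
    calc #(T.image h) ≤ #(univ : Finset (Fin c)) := Finset.card_le_univ _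
      _ = c := by simp
  omega

/-! ### The finite families of test graphs -/

/-- The positive test graphs of `CLIQUE(m, s)`: the clique vectors of all `s`-subsets of the
vertices (Jukna 2012, §9.1: "we have `(m choose s)` such graphs"). [cite: Jukna2012, §9.1] -/
noncomputable def posGraphs (m s : ℕ) : Finset ((⊤ : SimpleGraph (Fin m)).edgeSet → Bool) :=
  (powersetCard s (univ : Finset (Fin m))).image cliqueVec

/-- The negative test graphs of `CLIQUE(m, s)`: the colouring vectors of all colourings with
`s - 1` colours (Jukna 2012, §9.1; as a SET of graphs — multiplicities of colourings are a
matter for the counting arguments, not for this definition). [cite: Jukna2012, §9.1] -/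
noncomputable def negGraphs (m s : ℕ) : Finset ((⊤ : SimpleGraph (Fin m)).edgeSet → Bool) :=
  (univ : Finset (Fin m → Fin (s - 1))).image colorVec

/-- Positive test graphs are accepted. [cite: Jukna2012, §9.1] -/
theorem cliqueFn_of_mem_posGraphs {s : ℕ} {x : (⊤ : SimpleGraph (Fin m)).edgeSet → Bool}
    (hx : x ∈ posGraphs m s) : cliqueFn m s x = true := by
  obtain ⟨S, hS, rfl⟩ := Finset.mem_image.1 hx
  exact cliqueFn_cliqueVec (Finset.mem_powersetCard.1 hS).2.ge

/-- Negative test graphs are rejected (for `s ≥ 1`, so that `s - 1 < s`).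
[cite: Jukna2012, §9.1] -/
theorem cliqueFn_of_mem_negGraphs {s : ℕ} (hs : 1 ≤ s)
    {x : (⊤ : SimpleGraph (Fin m)).edgeSet → Bool} (hx : x ∈ negGraphs m s) :
    cliqueFn m s x = false := by
  obtain ⟨h, -, rfl⟩ := Finset.mem_image.1 hx
  exact cliqueFn_colorVec h (by omega)

/-- There are positive test graphs as soon as `s ≤ m`. [folklore] -/
theorem posGraphs_nonempty {s : ℕ} (hs : s ≤ m) : (posGraphs m s).Nonempty := by
  apply Finset.Nonempty.image
  rw [Finset.powersetCard_nonempty]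
  simpa using hs

/-- There are negative test graphs as soon as `2 ≤ s` (at least one colour), or `m = 0`.
[folklore] -/
theorem negGraphs_nonempty {s : ℕ} (hs : 2 ≤ s) : (negGraphs m s).Nonempty := by
  apply Finset.Nonempty.image
  have : NeZero (s - 1) := ⟨by omega⟩
  exact ⟨fun _ => 0, Finset.mem_univ _⟩

/-- Positive and negative test graphs are disjoint families (one is accepted, the other
rejected), for `s ≥ 1`. [folklore] -/
theorem disjoint_posGraphs_negGraphs {s : ℕ} (hs : 1 ≤ s) :
    Disjoint (posGraphs m s) (negGraphs m s) := by
  rw [Finset.disjoint_left]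
  intro x hpos hneg
  have h1 := cliqueFn_of_mem_posGraphs hpos
  have h2 := cliqueFn_of_mem_negGraphs hs hneg
  rw [h1] at h2
  exact Bool.noConfusion h2

end Literature.Computability.Complexity
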